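import Summits.ResolutionOfSingularities.ResolutionOfSingularities.Theorems.DeltaCutRefCells
import HarnessLib

/-!
# DeltaCutGrade — decomp-res node «GradeCut» (lens-6 g28, critic row 210 CLEARED (F-top eliminated; row-204 re-grant
spent)), tree file 1/3 of the node

Content VERBATIM from the decomp-res lens-6 g28 node `HOME/decomp-res-lens-6/g28/GradeCut.lean` (pin 594c5539 = PIN
STATUS :1832, 727 l; HOME = run/shared/lean/pub/decomp-res; companion certificate files `GradeCutCertificates.lean`
92912ba2 / `GradeCutCertificates2.lean` 5886ffab land separately as `DeltaCutGradeCertificates*`): NO carry — the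
node imports the LANDED `Theorems.DeltaCutRefCells` (g27 «RefCut», writer g13) + `HarnessLib` only; every
declaration is new, same namespace `…Theorems.DeltaCutClasses` (no collision with the landed files of that namespace
— checked by name at staging).  Farm (lens + critic): law rc 0 · 0 err · 0 warn · 0 sorry, std axioms (7 decls);
certificates rc 0 · 0 · 0 · 0.  Critic: CRITIC-LEDGER row 210 «GradeCut» CLEARED (PRICED DELIVERY under row 204's
RE-GRANT CLAUSE (i)–(iii), pre-priced (g1)–(g9)): THE GRADED REFINED CUT — SURFACE PART FIRST: at a refined-frozen
level with nothing pending whose SURFACE PART (`surfacePart` = closure of the union of the irreducible closed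
subsets of dimension `≥ 2` of the reduced bad closure) is REGULAR (`TopFrozen`), the graded hop `gHop` blows up
`𝓘(surface part)` (canonical, choice-free, ONE blow-up, no new state) and otherwise does g27's `refHop` VERBATIM
(`gRun_eq_refRun_of_not_gradeNow` / `_of_refMoves`); PERMISSIBILITY PROVED port-free (`gHop_facts`,
`support_surfaceCentre_subset`; nonempty centre `surfacePart_nonempty_of_not_dimLEOne` in kernel, 0 typed facts);
letters `GMoves` / `GTerminates` [DECIDED] | `GFrozen` [kind F-surf-sing] | `GPerpetual` [kind P″] (`g_trichotomy`,
`not_gTerminates_iff`, hyp-free; non-tautological `gStuck_iff_surfSing` / `not_gMoves_iff` /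
`gFrozen_iff_stuck_nonempty`); THE WHOLE SUB-KIND F-top IS ELIMINATED as a letter (`refFrozen_top_gMoves`;
`RefTerminates.gTerminates`, `RefPerpetual.gPerpetual`, `RefFrozen.gFrozen_of_not_surfaceRegular`); ONE engine
`wor_of_gTerminatesAt (h5 : SeqDimFour 5 n)` for all g-heights (+ `wor_of_gTerminates`, `gRun_facts`); cells
`WORTopRefHeavyGTame` [DECIDED: `worTopRefHeavyGTame_of_five`, `e1TopRefHeavyGTame_of_five (h5 : E 5)`; INHABITED by
G₀ = `z³ + t⁴u²w²`, char 3, certified DECIDED at g-height 2 in the certificates files] and **`WORTopGHeavy`** /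
**`E1TopGHeavy`** — THE LOCATED RESIDUAL after g28 = kind F-surf-sing `WORTopGFrozen` [INHABITED by H = `z³ + (t²w −
u²)⁴`, Whitney-umbrella bad closure] ∨ kind P″ `WORTopGPerpetual` [UNDECIDED · no inhabitant · absorbs F-top
recurrence] (`worTopGHeavy_iff_surfSing_perpetual` hyp-free, `worTopGHeavy_iff_intrinsic`); EXACT hyp-free carve
`worTopRefHeavy_iff_gHeavy_gTame` / `e1TopRefHeavy_iff_gHeavy_gTame`, RE-LOCATION `e1TopRefHeavy_iff_e1TopGHeavy (h5
: E 5)` and the column chain down to `e_one_iff_e1TopGHeavy (hSC) (h5)`.  Landing orders = the lens's plan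
`HOME/decomp-res-lens-6/g28/NEXT-g29.md` (320db171) §4 endorsed by the critic rider INBOX 2026-08-31T11:01:55Z: (A)
`DeltaCutGrade` = header + §GDefs, `DeltaCutGrade2` = the prefix identities + §GEngine (cut by the 400-line cap at
declaration boundaries, numbered consecutively; sections / section `open`s replayed), `DeltaCutGradeCells` = §GCells
(cone-free aside home of `E1TopGHeavy`); (B)/(C) `DeltaCutGradeCertificates*` = the certificate files; all VERBATIM,
`--kind proof --supports stmt-ResolutionOfSingularities-26971`, the HOME-only dupNamespace-linter line dropped.  The
`def … : Prop` tests / letters / cells (`SurfaceRegular`, `TopFrozen`, `GradeNow`, `GMoves`, `GTerminates`,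
`GFrozen`, `GPerpetual`, `WORTopRefHeavyGTame`, `WORTopGHeavy`, `E1TopRefHeavyGTame`, `E1TopGHeavy`,
`WORTopGFrozen`, `WORTopGPerpetual`, `E1TopGFrozen`, `E1TopGPerpetual`) are THIS node's cells (cn26) — none is a
vendored fact; `surfacePart` / `gHop` / `gRun` and their companions are data-valued definitions.  ASIDE (critic
rider (D): exactly ONE switch): `RCE1TopRefHeavy` (item 27045, rev 65) ⟶ ONE aside on `DeltaCutClasses.E1TopGHeavy`
(home `DeltaCutGradeCells`), re-location `e1TopRefHeavy_iff_e1TopGHeavy (h5 : E 5)` — filed by the writer's route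
edit after `DeltaCutGradeCells` lands.

The lens header, verbatim:

> # GradeCut — decomp-res node «GradeCut» (lens-6 g28; critic row 204 RE-GRANT clause): THE GRADED REFINED CUT —
SURFACE PART FIRST
>
> Host route `MaxContactCut` (route-ResolutionOfSingularities-o079-maxcontactcut), column item
`stmt-ResolutionOfSingularities-26971`
> (`E1TopNoAbs`); lens-6 DeltaCut column g22–g27: `E 1 ⟸ … ⟸ E1TopRefHeavy` (g27 «RefCut», landed `Theorems/DeltaCutRef*`,
> `DeltaCutRefCells`).  g27's located residual is `E1TopRefHeavy` = kind F-surface (`RefFrozen`: the refined separating run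
> freezes at a level with nothing pending, NONEMPTY bad locus, IRREGULAR reduced bad closure of dimension NOT `≤ 1`) ∨ kind P′
> (`RefPerpetual`).  Neither kind had an inhabitant on record; g28 REGISTERS two (file `GradeCutCertificates.lean`,
posted FIRST):
> G₀ = `z³ + t⁴u²w²` (char 3: bad closure = plane `∪` line, frozen at refined height `0`) and H = `z³ + (t²w − u²)⁴`
(char 3: bad
> closure = a Whitney umbrella).
>
> THE SUB-KIND F-top (stated BY MECHANISM before the build, INBOX 2026-08-31T10:11:35Z): a refined-frozen level
whose SURFACE PART —
> the closure of the union of the irreducible closed subsets of dimension `≥ 2` of the reduced bad closure (a canonical closed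
> subset: the union of its irreducible components of dimension `≥ 2`) — is a REGULAR scheme; the irregularity of the
closure then
> comes only from lower-dimensional components meeting the surface part (G₀: the line `V(z,u,w)` meeting the plane
`V(z,t)` at the
> origin).  THE LAW (`gHop`, canonical, choice-free, ONE blow-up, NO new state): at a level with nothing pending
that is `TopFrozen`
> (bad `≠ ∅`, closure irregular, not a curve, surface part regular) blow up `𝓘(surface part)` — the REDUCED regular
surface part —
> and pass to the controlled transform; at every other refined stage do g27's `refHop` VERBATIM (so on every level that is not
> `TopFrozen` the graded run IS the refined run: `gRun_eq_refRun_of_refMoves`).  PERMISSIBILITY IS PROVED, port-free, from tree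
> names only: the centre is regular by the test itself and lies inside the top locus because `surface part ⊆ closure bad ⊆ Supp`
> (`closure_badLocus_subset_support`, g26).  Letters `GTerminates | GFrozen | GPerpetual` (trichotomy, hypothesis-free); the
> WHOLE sub-kind F-top is ELIMINATED as a letter (`refFrozen_top_gMoves`: such a level MOVES, by the graded blow-up); ONE engine
> `wor_of_gTerminatesAt` for all heights from `SeqDimFour 5 n` (g27's engine + one hop case); cells `WORTopRefHeavyGTame`
> (DECIDED, proved from five; INHABITED by G₀: `GradeCutCertificates` §B/§C certify G₀ DECIDED at g-height `2`) and
`WORTopGHeavy`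
> (the LOCATED RESIDUAL: kind F-surf-sing = frozen with an IRREGULAR surface part — INHABITED by H — ∨ kind P″ =
g-perpetual — no
> inhabitant); exact hypothesis-free carve, RE-LOCATION `e1TopRefHeavy_iff_e1TopGHeavy (h5 : E 5)`, edges down to `E 1`.
>
> ## This file
>
> §GDefs — `surfacePart`, `SurfaceRegular`, `TopFrozen`, the graded hop `gHop` / run `gRun`, letters
`GMoves/GTerminates/GFrozen/
> GPerpetual`, prefix identities with g27's `refRun`, exclusivity, `g_trichotomy`, `not_gTerminates_iff`, and THE
SUB-KIND THEOREM
> `refFrozen_top_gMoves` (+ `RefTerminates.gTerminates`, `RefPerpetual.gPerpetual`, `RefFrozen.gFrozen_of_not_surfaceRegular`).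
> §GEngine — `support_surfaceCentre_subset`, `gHop_facts` (permissibility of EVERY graded hop PROVED), `wor_of_gTerminatesAt`,
> `wor_of_gTerminates`, `gRun_facts`.
> §GCells — `WORTopRefHeavyGTame` / `WORTopGHeavy` (+ `E1` families), `worTopRefHeavy_iff_gHeavy_gTame` (hyp-free),
> `worTopRefHeavyGTame_of_five`, `e1TopRefHeavyGTame_of_five`, RE-LOCATION `e1TopRefHeavy_iff_e1TopGHeavy`, the edges
> `e1TopSepHeavy/RunHeavy/ChainHeavy/DeltaHeavy/Heavy/NoAbs_iff_e1TopGHeavy`, `e_one_iff_e1TopGHeavy`, the residual's two kinds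
> `WORTopGFrozen` (F-surf-sing) / `WORTopGPerpetual` (P″) with the exact carve
`worTopGHeavy_iff_surfSing_perpetual`, and the intrinsic
> reading `worTopGHeavy_iff_intrinsic`.
>
> Provenance: HOME = run/shared/lean/pub/decomp-res, lens-6 g28 (unit decomp-res-lens-6-g28); `--supports
stmt-ResolutionOfSingularities-26971`.
> Imports the LANDED `Theorems.DeltaCutRefCells` (g27, writer g13) + `HarnessLib` only — NO carry; every declaration
is new, namespace
> `…Theorems.DeltaCutClasses`.  (Sources: Hironaka1964 (permissible centres inside the Samuel stratum);
CossartJannsenSaito2020 Ch. 5–8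
> (canonical strategy: blow up the maximal-dimensional regular part of the singular stratum, «old components
first»); CossartPiltant2019
> Prop. 2.6; Giraud1975; EGAIV2 §5–§6 (dimension of components); StacksProject 0BIQ / 035A / 0804; Matsumura1987
§28–§31; Kollar2007 §3.)

## This file

§GDefs — THE GRADED REFINED RUN (data + letters): `surfacePart` (closure of the union of the irreducible closed
subsets of dimension `≥ 2` of the reduced bad closure), the tests `SurfaceRegular` / `TopFrozen` / `GradeNow`, the
graded hop `gHop` / run `gRun` (Nat.rec), letters `GMoves`, `GTerminates` [DECIDED], `GFrozen` [kind F-surf-sing],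
`GPerpetual` [kind P″]; the prefix identities with g27's `refRun` (`gRun_eq_refRun_of_not_gradeNow` /
`_of_refMoves`, `not_gradeNow_of_refMoves`), exclusivity, `g_trichotomy`, `not_gTerminates_iff`,
`gStuck_iff_surfSing` / `not_gMoves_iff` / `gFrozen_iff_stuck_nonempty`, THE SUB-KIND THEOREM `refFrozen_top_gMoves`
(+ `RefTerminates.gTerminates`, `RefPerpetual.gPerpetual`, `RefFrozen.gFrozen_of_not_surfaceRegular`,
`RefFrozen.gMoves_or_gFrozen`); §GEngine — `support_surfaceCentre_subset`, `surfacePart_nonempty_of_not_dimLEOne`,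
`gHop_facts` (permissibility of EVERY graded hop PROVED), `wor_of_gTerminatesAt` (all g-heights, `h5 : SeqDimFour 5
n`), `wor_of_gTerminates`, `gRun_facts`.  (The 400-line cap cuts this group into 2 files; this first part carries:
`surfacePart`, `surfacePart_subset`, `subset_surfacePart`, `not_topologicalKrullDim_le_one_of_specializes`,
`surfacePart_nonempty_of_not_dimLEOne`, `SurfaceRegular`, `TopFrozen`, `GradeNow`, `GradeNow.surfacePart_nonempty`,
`gHop`, `gRun`, `gRun_zero`, `gRun_succ`, `gRunHom`, `gRun_succ_front`, `gHop_eq_grade`, `gHop_eq_refHop`, `GMoves`,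
`GTerminates`, `GFrozen`, `GPerpetual`, `not_gradeNow_of_refMoves`, `not_gMoves_iff`.)

[WRITER NOTE (decomp-res writer g13): file split only (tree files ≤ 400 lines; the plan's section groups, cut
further by the cap at declaration boundaries); namespace, sections, section `open`s / `variable`s and every
declaration exactly as in the lens (the node's HOME-only dupNamespace-linter line is dropped — the library sets it;
`noncomputable section`, the two file-level `open` lines, `universe u` and the namespace-level `open
…TwistCutClasses` / `open …LightCutClasses` of the node are replayed in every file).]

(Sources: Hironaka1964; CossartJannsenSaito2020 Ch. 5–8; CossartPiltant2019 Prop. 2.6; Giraud1975; EGAIV2 §5–§6;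
StacksProject 0BIQ / 035A / 0804; Matsumura1987 §28–§31; Kollar2007 §3.)
-/

noncomputable section

open CategoryTheory CategoryTheory.Limits AlgebraicGeometry TopologicalSpace IsLocalRing
open Literature.AlgebraicGeometry.Resolution

universe u

namespace Summit.ResolutionOfSingularities.ResolutionOfSingularities.Theorems.DeltaCutClasses

open Summit.ResolutionOfSingularities.ResolutionOfSingularities.Theorems.TwistCutClasses
open Summit.ResolutionOfSingularities.ResolutionOfSingularities.Theorems.LightCutClasses

section GDefs

open Summit.ResolutionOfSingularities.ResolutionOfSingularities.Theorems
open WeakOrderReduction ForcedTowerClasses SubfieldContactClasses AbsoluteContactClasses PurityValveClasses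
open Scheme.IdealSheafData (vanishingIdeal)

/-! ### §GDefs — THE SURFACE PART, THE GRADED HOP (one canonical blow-up at `TopFrozen` levels, g27's `refHop` elsewhere), ITS
RUN, ITS LETTERS, TRICHOTOMY, and THE SUB-KIND THEOREM -/

/-- **THE SURFACE PART of a closed subset `S ⊆ Y`**: the closure of the union of the IRREDUCIBLE CLOSED subsets of `S` of
(topological Krull) dimension NOT `≤ 1` — i.e. the union of the irreducible components of `S` of dimension `≥ 2` (every such
component is in the family and every member lies in one; the closure only removes the need to invoke finiteness of the set of
components).  A CANONICAL closed subset of `S`. DEFINITION (support). -/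
def surfacePart {Y : Scheme.{0}} (S : Closeds Y) : Closeds Y :=
  ⟨closure (⋃₀ {Z : Set Y | IsIrreducible Z ∧ IsClosed Z ∧ Z ⊆ (S : Set Y) ∧ ¬ topologicalKrullDim Z ≤ 1}), isClosed_closure⟩

/-- the surface part of `S` lies inside `S`. [folklore] -/
theorem surfacePart_subset {Y : Scheme.{0}} (S : Closeds Y) : (surfacePart S : Set Y) ⊆ (S : Set Y) :=
  closure_minimal (Set.sUnion_subset fun _ hZ => hZ.2.2.1) S.isClosed

/-- every irreducible closed subset of `S` of dimension not `≤ 1` lies in the surface part (in particular every irreducible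
component of `S` of dimension `≥ 2`; conversely every member of the defining family lies in such a component, so the
surface part
IS the union of the irreducible components of dimension `≥ 2` — closed when they are finitely many, e.g. on a Noetherian stage).
[folklore] -/
theorem subset_surfacePart {Y : Scheme.{0}} (S : Closeds Y) {Z : Set Y} (hirr : IsIrreducible Z) (hcl : IsClosed Z)
    (hZS : Z ⊆ (S : Set Y)) (hdim : ¬ topologicalKrullDim Z ≤ 1) : Z ⊆ (surfacePart S : Set Y) :=
  (Set.subset_sUnion_of_mem (S := {Z : Set Y | IsIrreducible Z ∧ IsClosed Z ∧ Z ⊆ (S : Set Y) ∧ ¬ topologicalKrullDim Z ≤ 1})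
    ⟨hirr, hcl, hZS, hdim⟩).trans subset_closure

/-- **A CHAIN OF THREE PROPER SPECIALISATIONS FORCES DIMENSION `≥ 2`** (pure topology: their closures are a chain of
length `2` of irreducible closed subsets). [folklore] -/
theorem not_topologicalKrullDim_le_one_of_specializes {X : Type*} [TopologicalSpace X] {a b c : X}
    (hba : b ⤳ a) (hab : ¬ a ⤳ b) (hcb : c ⤳ b) (hbc : ¬ b ⤳ c) : ¬ topologicalKrullDim X ≤ 1 := by
  have hlt : ∀ {x y : X}, y ⤳ x → ¬ x ⤳ y →
      (⟨closure {x}, isIrreducible_singleton.closure, isClosed_closure⟩ : IrreducibleCloseds X) <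
        ⟨closure {y}, isIrreducible_singleton.closure, isClosed_closure⟩ := by
    intro x y hyx hxy
    rw [← SetLike.coe_ssubset_coe]
    exact ⟨specializes_iff_closure_subset.1 hyx, fun h => hxy (specializes_iff_closure_subset.2 h)⟩
  intro h1
  let p : LTSeries (IrreducibleCloseds X) :=
    ((RelSeries.singleton _ ⟨closure {a}, isIrreducible_singleton.closure, isClosed_closure⟩).snoc
      ⟨closure {b}, isIrreducible_singleton.closure, isClosed_closure⟩ (hlt hba hab)).snoc
      ⟨closure {c}, isIrreducible_singleton.closure, isClosed_closure⟩ (by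
        rw [RelSeries.last_snoc]; exact hlt hcb hbc)
  have hp : p.length = 2 := rfl
  have h2 : ((p.length : ℕ) : WithBot ℕ∞) ≤ 1 := (Order.LTSeries.length_le_krullDim p).trans h1
  rw [hp] at h2
  have h3 : (2 : ℕ) ≤ 1 := by exact_mod_cast h2
  omega

/-- **THE SURFACE PART OF A CLOSED SUBSET OF DIMENSION NOT `≤ 1` IS NONEMPTY** (so the graded centre below is a GENUINE blow-up,
never the blow-up of the empty centre): a chain `C₀ ⊊ C₁ ⊊ C₂` of irreducible closed subsets of the reduced subscheme `S_red`
has generic points `c₂ ⤳ c₁ ⤳ c₀` (properly; `S_red` is sober); their images in `Y` lie in the irreducible closed subset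
`closure {c₂} ⊆ S`, which therefore carries three proper specialisations: dimension `≥ 2`.
(Sources: GortzWedhorn2020 (5.3)–(5.7); StacksProject 0055 / 004W; EGAIV2 §5.1.) [new] [folklore] -/
theorem surfacePart_nonempty_of_not_dimLEOne {Y : Scheme.{0}} (S : Closeds Y) (h : ¬ DimLEOne S) :
    ((surfacePart S : Set Y)).Nonempty := by
  classical
  -- a chain of length ≥ 2 of irreducible closed subsets of the reduced subscheme
  have hex : ∃ q : LTSeries (IrreducibleCloseds ↥(vanishingIdeal S).subscheme), 2 ≤ q.length := by
    by_contra hne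
    have hne' : ∀ q : LTSeries (IrreducibleCloseds ↥(vanishingIdeal S).subscheme), q.length ≤ 1 := fun q =>
      Nat.lt_succ_iff.mp (not_le.mp fun hq => hne ⟨q, hq⟩)
    refine h ?_
    unfold DimLEOne topologicalKrullDim Order.krullDim
    exact iSup_le fun q => by exact_mod_cast hne' q
  obtain ⟨q, hq⟩ := hex
  have h01 : q.toFun ⟨0, by omega⟩ < q.toFun ⟨1, by omega⟩ := q.strictMono (Fin.mk_lt_mk.2 (by norm_num))
  have h12 : q.toFun ⟨1, by omega⟩ < q.toFun ⟨2, by omega⟩ := q.strictMono (Fin.mk_lt_mk.2 (by norm_num))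
  -- generic points of a strict pair specialise properly
  have key : ∀ {C C' : IrreducibleCloseds ↥(vanishingIdeal S).subscheme}, C < C' →
      C'.isIrreducible.genericPoint ⤳ C.isIrreducible.genericPoint ∧
        ¬ C.isIrreducible.genericPoint ⤳ C'.isIrreducible.genericPoint := by
    intro C C' hlt
    have hC : IsGenericPoint C.isIrreducible.genericPoint (C : Set _) :=
      C.isIrreducible.isGenericPoint_genericPoint C.isClosed
    have hC' : IsGenericPoint C'.isIrreducible.genericPoint (C' : Set _) :=
      C'.isIrreducible.isGenericPoint_genericPoint C'.isClosed
    have hss : (C : Set ↥(vanishingIdeal S).subscheme) ⊂ (C' : Set ↥(vanishingIdeal S).subscheme) :=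
      SetLike.coe_ssubset_coe.2 hlt
    refine ⟨hC'.specializes_iff_mem.2 (hss.1 hC.mem), fun hsp => hss.2 ?_⟩
    rw [← hC'.def]
    exact closure_minimal (Set.singleton_subset_iff.2 (hC.specializes_iff_mem.1 hsp)) C.isClosed
  obtain ⟨h10, hn01⟩ := key h01
  obtain ⟨h21, hn12⟩ := key h12
  -- transport along the closed immersion `S_red ⟶ Y`
  have hrange : Set.range ⇑(vanishingIdeal S).subschemeι = (S : Set Y) := by
    rw [Scheme.IdealSheafData.range_subschemeι, Scheme.IdealSheafData.coe_support_vanishingIdeal]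
  have hind : Topology.IsInducing ⇑(vanishingIdeal S).subschemeι :=
    (vanishingIdeal S).subschemeι.isClosedEmbedding.toIsEmbedding.toIsInducing
  set ι := ⇑(vanishingIdeal S).subschemeι with hι
  set c₀ := (q.toFun ⟨0, by omega⟩).isIrreducible.genericPoint
  set c₁ := (q.toFun ⟨1, by omega⟩).isIrreducible.genericPoint
  set c₂ := (q.toFun ⟨2, by omega⟩).isIrreducible.genericPoint
  have g10 : ι c₁ ⤳ ι c₀ := hind.specializes_iff.2 h10
  have g21 : ι c₂ ⤳ ι c₁ := hind.specializes_iff.2 h21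
  have gn01 : ¬ ι c₀ ⤳ ι c₁ := fun h' => hn01 (hind.specializes_iff.1 h')
  have gn12 : ¬ ι c₁ ⤳ ι c₂ := fun h' => hn12 (hind.specializes_iff.1 h')
  -- the irreducible closed subset `closure {ι c₂} ⊆ S` carries the three points
  have m₂ : ι c₂ ∈ closure ({ι c₂} : Set Y) := subset_closure rfl
  have m₁ : ι c₁ ∈ closure ({ι c₂} : Set Y) := specializes_iff_mem_closure.1 g21
  have m₀ : ι c₀ ∈ closure ({ι c₂} : Set Y) := specializes_iff_mem_closure.1 (g21.trans g10)
  have hZS : closure ({ι c₂} : Set Y) ⊆ (S : Set Y) :=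
    closure_minimal (Set.singleton_subset_iff.2 (hrange ▸ Set.mem_range_self _)) S.isClosed
  have hZdim : ¬ topologicalKrullDim ↥(closure ({ι c₂} : Set Y)) ≤ 1 := by
    let z₀ : ↥(closure ({ι c₂} : Set Y)) := ⟨ι c₀, m₀⟩
    let z₁ : ↥(closure ({ι c₂} : Set Y)) := ⟨ι c₁, m₁⟩
    let z₂ : ↥(closure ({ι c₂} : Set Y)) := ⟨ι c₂, m₂⟩
    exact not_topologicalKrullDim_le_one_of_specializes (a := z₀) (b := z₁) (c := z₂)
      ((subtype_specializes_iff z₁ z₀).2 g10) (fun h' => gn01 ((subtype_specializes_iff z₀ z₁).1 h'))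
      ((subtype_specializes_iff z₂ z₁).2 g21) (fun h' => gn12 ((subtype_specializes_iff z₁ z₂).1 h'))
  exact ⟨_, subset_surfacePart S isIrreducible_singleton.closure isClosed_closure hZS hZdim m₂⟩

/-- `SurfaceRegular n N` — the REDUCED induced structure on the surface part of the bad closure is a REGULAR scheme
(the g28 test).
DEFINITION (letter). -/
def SurfaceRegular (n : ℕ) (N : Stage) : Prop := ReducedRegular (surfacePart (badClosure n N))

/-- `TopFrozen n N` — the level is refined-FROZEN (nonempty bad locus, irregular reduced closure, not a curve) WITH A REGULAR
SURFACE PART: the sub-kind F-top of g27's kind F-surface (G₀ = `z³ + t⁴u²w²` at level `0`). DEFINITION (letter). -/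
def TopFrozen (n : ℕ) (N : Stage) : Prop :=
  ¬ BadEmpty n N ∧ ¬ ClosureRegular n N ∧ ¬ DimLEOne (badClosure n N) ∧ SurfaceRegular n N

/-- `GradeNow n R` — the graded hop FIRES at the refined stage `R`: nothing pending and the base level is `TopFrozen`.
DEFINITION (letter). -/
def GradeNow (n : ℕ) (R : RefStage) : Prop := R.pending = none ∧ TopFrozen n R.base

/-- **AT A FIRING STAGE THE GRADED CENTRE IS NONEMPTY** (the closure is not a curve, so it has an irreducible component of
dimension `≥ 2`): the graded hop below is a genuine blow-up. [new] [folklore] -/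
theorem GradeNow.surfacePart_nonempty {n : ℕ} {R : RefStage} (h : GradeNow n R) :
    ((surfacePart (badClosure n R.base) : Set R.base.Y)).Nonempty :=
  surfacePart_nonempty_of_not_dimLEOne _ h.2.2.2.1

open Classical in
/-- **THE GRADED REFINED HOP** (canonical, choice-free, NO new state): at a `TopFrozen` level with nothing pending, blow up the
REDUCED SURFACE PART `𝓘(surface part of the bad closure)` (g27's exit-shaped hop `RefStage.exit` at that closed
subset: controlled
transform, nothing pending); everywhere else g27's `refHop` VERBATIM. DEFINITION (the step of the graded run). -/
def gHop (n : ℕ) (R : RefStage) : RefHop R :=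
  if GradeNow n R then R.exit n (surfacePart (badClosure n R.base)) else refHop n R

/-- **THE GRADED REFINED RUN** `gRun n R : ℕ → RefStage` — iterate the graded hop (`Nat.rec`, END-iteration, as `refRun`).
DEFINITION (the object). -/
def gRun (n : ℕ) (R : RefStage) : ℕ → RefStage := fun i => Nat.rec R (fun _ P => (gHop n P).next) i

/-- level `0` of the graded run is the refined stage itself. [folklore] -/
@[simp] theorem gRun_zero (n : ℕ) (R : RefStage) : gRun n R 0 = R := rfl

/-- level `i+1` of the graded run is the graded hop of level `i`. [folklore] -/
theorem gRun_succ (n : ℕ) (R : RefStage) (i : ℕ) : gRun n R (i + 1) = (gHop n (gRun n R i)).next := rfl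

/-- **THE HOP MORPHISMS OF THE GRADED RUN**. DEFINITION (support). -/
def gRunHom (n : ℕ) (R : RefStage) (i : ℕ) : (gRun n R (i + 1)).base.Y ⟶ (gRun n R i).base.Y := (gHop n (gRun n R i)).hom

/-- the graded run of the next stage is the tail of the graded run. [folklore] -/
theorem gRun_succ_front (n : ℕ) (R : RefStage) : ∀ i : ℕ, gRun n R (i + 1) = gRun n (gHop n R).next i
  | 0 => rfl
  | i + 1 => by
    show (gHop n (gRun n R (i + 1))).next = (gHop n (gRun n (gHop n R).next i)).next
    rw [gRun_succ_front n R i]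

/-- at a firing stage the graded hop is the blow-up of the reduced surface part. [folklore] -/
theorem gHop_eq_grade {n : ℕ} {R : RefStage} (h : GradeNow n R) :
    gHop n R = R.exit n (surfacePart (badClosure n R.base)) := by
  unfold gHop; rw [if_pos h]

/-- at a non-firing stage the graded hop is g27's refined hop. [folklore] -/
theorem gHop_eq_refHop {n : ℕ} {R : RefStage} (h : ¬ GradeNow n R) : gHop n R = refHop n R := by
  unfold gHop; rw [if_neg h]

/-! #### Letters -/

/-- `GMoves n R` — the graded hop MOVES at `R`: g27's refined hop moves, or the graded hop fires. DEFINITION (letter). -/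
def GMoves (n : ℕ) (R : RefStage) : Prop := RefMoves n R ∨ GradeNow n R

/-- **`GTerminates n R`** — the graded run TERMINATES: a moving prefix, then a level with nothing pending and EMPTY bad locus.
DEFINITION (letter; the DECIDED kind). -/
def GTerminates (n : ℕ) (R : RefStage) : Prop :=
  ∃ h : ℕ, (∀ j < h, GMoves n (gRun n R j)) ∧ (gRun n R h).pending = none ∧ BadEmpty n (gRun n R h).base

/-- **`GFrozen n R`** — the graded run FREEZES: a moving prefix, then a level with nothing pending, NONEMPTY bad
locus, IRREGULAR
reduced closure, not a curve, AND AN IRREGULAR SURFACE PART (kind F-surf-sing; inhabitant H = `z³ + (t²w − u²)⁴`, char 3).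
DEFINITION (letter; RESIDUAL). -/
def GFrozen (n : ℕ) (R : RefStage) : Prop :=
  ∃ h : ℕ, (∀ j < h, GMoves n (gRun n R j)) ∧ (gRun n R h).pending = none ∧ ¬ BadEmpty n (gRun n R h).base ∧
    ¬ ClosureRegular n (gRun n R h).base ∧ ¬ DimLEOne (badClosure n (gRun n R h).base) ∧ ¬ SurfaceRegular n (gRun n R h).base

/-- **`GPerpetual n R`** — the graded run is PERPETUAL: every level moves (kind P″).  UNDECIDED · NO INHABITANT KNOWN · never
«expected-empty».  P″ ABSORBS g27's P′ (`RefPerpetual.gPerpetual`) AND THE RECURRENCE OF F-top: a run that meets F-top levels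
infinitely often (each one fires the graded hop and moves on) is PERPETUAL, not eliminated — the node eliminates
F-top LEVELS, not
F-top RECURRENCE (whose termination is an invariant-size question).  DEFINITION (letter; RESIDUAL). -/
def GPerpetual (n : ℕ) (R : RefStage) : Prop := ∀ i : ℕ, GMoves n (gRun n R i)

/-- a refined stage that MOVES under g27's hop is NOT a firing stage of the graded hop (a pending phase, an active level or a
curve-frozen level is never `TopFrozen` with nothing pending). [new] [folklore] -/
theorem not_gradeNow_of_refMoves {n : ℕ} {R : RefStage} (h : RefMoves n R) : ¬ GradeNow n R := by
  rintro ⟨hP, hT⟩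
  rcases h with h | h | h
  · rw [hP] at h; exact Bool.false_ne_true h
  · exact hT.2.1 h.2
  · exact hT.2.2.1 h.2.2

/-- **THE NON-MOVING LEVELS READ EXACTLY**: the graded hop does not move iff nothing is pending and the level is bad-empty or
frozen at an irregular non-curve closure WITH AN IRREGULAR SURFACE PART. [new] [folklore] -/
theorem not_gMoves_iff {n : ℕ} {R : RefStage} : ¬ GMoves n R ↔ R.pending = none ∧
    (BadEmpty n R.base ∨ (¬ BadEmpty n R.base ∧ ¬ ClosureRegular n R.base ∧ ¬ DimLEOne (badClosure n R.base) ∧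
      ¬ SurfaceRegular n R.base)) := by
  constructor
  · intro h
    obtain ⟨hP, hc⟩ := not_refMoves_iff.mp fun hm => h (Or.inl hm)
    refine ⟨hP, hc.imp id fun ⟨hne, hirr, hdim⟩ => ⟨hne, hirr, hdim, fun hs => h (Or.inr ⟨hP, hne, hirr, hdim, hs⟩)⟩⟩
  · rintro ⟨hP, hc⟩ (hm | ⟨_, hT⟩)
    · exact not_refMoves_iff.mpr ⟨hP, hc.imp id fun ⟨hne, hirr, hdim, _⟩ => ⟨hne, hirr, hdim⟩⟩ hm
    · rcases hc with he | ⟨_, _, _, hs⟩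
      · exact hT.1 he
      · exact hs hT.2.2.2

end GDefs

end Summit.ResolutionOfSingularities.ResolutionOfSingularities.Theorems.DeltaCutClasses
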